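import Summits.HodgeConjecture.HodgeConjecture.Theorems.F1ExtHodgeTypeStubS2Imm
import Literature.AlgebraicGeometry.ShimuraVarieties.UnitaryAuxiliaryPeriodMap
import HarnessLib

/-!
# `stub_S2imm` discharged: `QArch.S2Imm` holds (T3 v4 line `F1ExtHodgeType`, crux `HCCMUnconditional.HDel`)

Cell hodgecm-mathlib, fan B, KEY `wake/KEY-hodgecm-mathlib-B-p05-t3-stub-s2imm-period-map.md` (B-plan2, B-p05).
★ `S2Imm_of_periodChart (hP) : S2Imm` reduced the registered stub `stub_S2imm : QArch.S2Imm` to its ONE analytic input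
`hP` («period chart»: for every `γ ∈ GSp_δ(ℝ)` with `γ J_{β,Φ}(x) γ⁻¹ ∈ S⁺` on the ball, a holomorphic `P : 𝔹² → ℂ^{g(g+1)/2}`
with injective differential, `P(x) ∈ 𝔥_g`, `γ J_{β,Φ}(x) γ⁻¹ = J(Z(P x))`); ★ `UnitaryCanonicalModel.Aux.periodChart`
(`Literature/AlgebraicGeometry/ShimuraVarieties/UnitaryAuxiliaryPeriodMap.lean`, «left eigenrows»: `Z = Δ·R₂⁻¹·R₁` with
`R(u)` affine in `u`) supplies exactly that input (its statement omits the two idle hypotheses `IsAuxScalars`, `0 < g`).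

* `stub_periodChart_holds` — the `hP` hypothesis of ★ `S2Imm_of_periodChart`, verbatim (B-plan2 v4.3 `stub_periodChart`);
* `stub_S2imm_holds : QArch.S2Imm`.

HC_CM is proved only modulo the 7 printed citations until rung 0 closes.
-/

set_option autoImplicit false
set_option linter.dupNamespace false

noncomputable section

open Function NumberField Matrix
open scoped Matrix ComplexOrder
open Literature.AlgebraicGeometry Literature.AlgebraicGeometry.Motives
open Literature.NumberTheory.Automorphic
open Literature.Geometry.ComplexHyperbolic Literature.Geometry.ComplexHyperbolic.BallModel
open Literature.AlgebraicGeometry.ShimuraVarieties Literature.AlgebraicGeometry.ShimuraVarieties.UnitaryCanonicalModel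
open Literature.AlgebraicGeometry.ShimuraVarieties.UnitaryCanonicalModel.Aux
open Literature.AlgebraicGeometry.ModuliOfAbelianVarieties
open Literature.AlgebraicGeometry.ModuliOfAbelianVarieties.SiegelModuli (C0 jOfSiegel)
open Literature.NumberTheory.ModularForms.SiegelUpperHalfSpace (siegelUpperHalfSpaceCoord coordCLE)
open Literature.LinearAlgebra.Matrix (symmetricSubmodule)
open Summit.HodgeConjecture.CorCM.HypDel.ExtReceptacle.QArch

namespace Summit.HodgeConjecture.HodgeConjecture.Theorems

/-- **The period chart of `J_{β,Φ}`, in the exact `hP` shape of ★ `S2Imm_of_periodChart`** (B-plan2 v4.3 `stub_periodChart`):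
★ `UnitaryCanonicalModel.Aux.periodChart` with the idle hypotheses `IsAuxScalars`, `0 < g` re-inserted.
[cite: Deligne1971TravauxShimura, 1.14–1.15] -/
theorem stub_periodChart_holds :
    ∀ (L : Type) [Field L] [NumberField L] [IsCMField L] (H : Matrix (Fin 3) (Fin 3) L) (τ : L →+* ℂ)
      (T : GL (Fin 3) ℂ), formCongr (starRingEnd ℂ) T (H.map τ) = BallModel.J →
      (∀ τ' : L →+* ℂ, InfinitePlace.mk τ' ≠ InfinitePlace.mk τ → (H.map τ').PosDef) →
      ∀ (M : Type) [Field M] [NumberField M] [IsCMField M] (j : L →+* M) (Φ : CMType M), IsExtAdapted τ j Φ →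
      ∀ (ξ₀ ξ : M) (g : ℕ) (δ : Fin g → ℕ) (F : SymplecticFrame M j H ξ₀ ξ g δ),
      IsAuxScalars M Φ ξ₀ ξ → 0 < g → IsPolarizationType δ →
      ∀ γ : ↥(gspReal δ), (∀ x : Ball, conjJ (γ : GL (Fin g ⊕ Fin g) ℝ) (auxComplexStructure F τ Φ T x) ∈ C0 δ) →
        ∃ P : (Fin 2 → ℂ) → (Sym2 (Fin g) → ℂ), DifferentiableOn ℂ P BallForms.ballSet ∧
          (∀ w ∈ BallForms.ballSet, Function.Injective (fderiv ℂ P w)) ∧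
          ∀ x : Ball, P x.1 ∈ siegelUpperHalfSpaceCoord g ∧
            conjJ (γ : GL (Fin g ⊕ Fin g) ℝ) (auxComplexStructure F τ Φ T x) =
              jOfSiegel δ (((coordCLE g).symm (P x.1) : symmetricSubmodule (Fin g) ℂ) : Matrix (Fin g) (Fin g) ℂ) :=
  fun L _ _ _ H τ T hT hpos M _ _ _ j Φ hΦ ξ₀ ξ g δ F _ _ hδ γ hγ =>
    periodChart L H τ T hT hpos M j Φ hΦ ξ₀ ξ g δ F hδ γ hγ

/-- **`stub_S2imm` holds**: `QArch.S2Imm` (every `ι'` with the N-level point formula and injective parameters is a closed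
immersion) — ★ `S2Imm_of_periodChart` fed with ★ `stub_periodChart_holds`.
[cite: Deligne1971TravauxShimura, Prop. 1.15 and 1.14] [cite: SGA1, Exp. XII Prop. 3.1] -/
theorem stub_S2imm_holds : S2Imm :=
  S2Imm_of_periodChart stub_periodChart_holds

end Summit.HodgeConjecture.HodgeConjecture.Theorems
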